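import Mathlib.Analysis.SpecificLimits.Basic
import Mathlib.Algebra.QuadraticDiscriminant
import Mathlib.LinearAlgebra.BilinearMap
import HarnessLib

/-!
# Schwarz constants and Schwarz quotients: monotonicity and convergence of the Rayleigh quotients of the iterates
# `v, Kv, K²v, …` of a positive symmetric operator (power iteration / Kellogg's method), with a comparison principle

Printed source: L. Råde, B. Westergren, *Mathematics Handbook for Science and Engineering* (4th ed., Springer 1999), §12.1
«Eigenvalue problems», paragraph «Iteration for λ₁ and v₁»: for a self-adjoint, totally (positive) definite problem the SCHWARZ CONSTANTS
`a_k = (u_{k−m} | A u_m)` are «independent of `m`» and the SCHWARZ QUOTIENTS `μ_k = a_{k−1}/a_k` converge MONOTONICALLY to the extreme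
eigenvalue («`μ_k ↘ λ₁`», inverse iteration) [held: `book:rade1999-mathematics-handbook` chunk p0290]; the classical treatment is Collatz's
(Eigenwertaufgaben / Functional Analysis and Numerical Mathematics §«Schwarzsche Konstanten und Quotienten»).  We state the DIRECT-iteration
form (`a_n = B(v, Kⁿv)`, quotients `a_{n+1}/a_n` NONDECREASING to the top of the spectral measure of `v`), and we separate the two layers:

§1 SEQUENCE LAYER (pure real analysis; the consumable core).  For `s : ℕ → ℝ` positive and LOG-CONVEX, `s(n+1)² ≤ s(n)s(n+2)`:
  * `pos_of_logConvex` (`s₀, s₁ > 0 ⇒ sₙ > 0`), `quot_mono` (the quotients `s(n+1)/s(n)` are nondecreasing — Cauchy–Schwarz in sequence form),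
    `mul_pow_quot_le` (`s(N)·q(N)^k ≤ s(N+k)`: geometric growth at least at the current quotient), `le_mul_pow_of_quot_le` (`sₙ ≤ s₀ρⁿ` if all
    quotients are `≤ ρ`);
  * with a bound `s(n+1)/s(n) ≤ M`: `tendsto_quot` (the quotients converge to `ρ := ⨆ₙ s(n+1)/s(n)`), `quot_le_ciSup`, `ciSup_quot_le`,
    `tendsto_quot_two_mul` (so do the even-indexed ones `s(2m+1)/s(2m)` = Rayleigh quotients of the iterates);
  * ★ `quot_zero_le_ciSup_of_le_mul` — COMPARISON PRINCIPLE: if `t` is a log-convex sequence with `t₀ > 0` and `tₙ ≤ c·sₙ` for all `n`,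
    then `t₁/t₀ ≤ ρ(s)` (a vector dominated in all moments by `v` has Rayleigh quotient below the growth rate of `v`).
§2 OPERATOR LAYER (the printed statement).  `V` a real vector space, `B : V →ₗ V →ₗ ℝ` a symmetric positive-semidefinite bilinear form
  (Cauchy–Schwarz `bilin_sq_le` proved from the discriminant), `K : V →ₗ V` `B`-symmetric (`B(Kx, y) = B(x, Ky)`) and `B`-positive
  (`B(Kx, x) ≥ 0`), `v ∈ V`, Schwarz constants `aₙ := B(v, Kⁿv)`:
  * `bilin_iterate_iterate` — «independent of `m`»: `B(Kⁱv, Kʲv) = B(v, K^{i+j}v)`; `schwarz_nonneg`; ★ `schwarz_logConvex` (`a(n+1)² ≤ a(n)a(n+2)`: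
    Cauchy–Schwarz for `B` at even `n`, for the form `B(K·, ·)` at odd `n` — the «dyadic Cauchy–Schwarz»);
  * ★ `rayleigh_iterate_mono` / `tendsto_rayleigh_iterate` / `rayleigh_le_ciSup` / `ciSup_le_of_rayleigh_le`: if `aₙ > 0` and the Rayleigh
    quotients along the orbit are bounded, `B(Kᵐv, K^{m+1}v) ≤ M·B(Kᵐv, Kᵐv)`, then `m ↦ R(Kᵐv) := B(Kᵐv, K·Kᵐv)/B(Kᵐv, Kᵐv)` is NONDECREASING and
    CONVERGES to `ρ(v) := ⨆ₙ a(n+1)/a(n) ∈ [R(v), M]` — no compactness, no Perron–Frobenius, no spectral theorem;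
  * ★ `rayleigh_le_ciSup_of_dominated` — comparison: if `w` has `B(w,w) > 0` and `B(w, Kⁿw) ≤ c·B(v, Kⁿv)` for all `n` then `R(w) ≤ ρ(v)`.
    (For a transfer operator with pointwise-positive kernel and `v = 1`: every bounded `ψ` is dominated with `c = sup ψ²`, so
    `ρ(1) = sup_ψ R(ψ) = λ₀` and `R(Kᵐ1) ↑ λ₀` — the «vacuum proxy» by free-boundary slabs.)

Use (cell `ym-beyond`, route `LuscherReduction`, crux RED, owner input №3 «slab currency», support `tendsto_rayleigh_slabGround`:
`Φ_m = K_β^m 1`, `R(Φ_m) → λ₀(L, β)` at fixed lattice): §2 with `B = l2`, `K = transferApply β` on bounded physical functions, or §1 directly on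
`sₙ = ⟨1, K^n 1⟩` after the consumer's own Cauchy–Schwarz.  No definitions, no named facts.

## References
* L. Råde, B. Westergren, *Mathematics Handbook for Science and Engineering*, 4th ed., Springer 1999, §12.1 (Schwarz' constants and quotients). [RadeWestergren1999]
* G. H. Golub, C. F. Van Loan, *Matrix Computations*, 4th ed., 2013, §8.2 (the power method and Rayleigh quotients for symmetric matrices). [GolubVanLoan2013]
-/

set_option autoImplicit false

open Filter Topology

namespace Literature.Analysis.OperatorTheory.SchwarzQuotients

/-! ## §1 Positive log-convex sequences -/

section Seq

variable {s : ℕ → ℝ}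

/-- A log-convex sequence with `s₀, s₁ > 0` is positive. [cite: RadeWestergren1999, §12.1 (Schwarz' constants)] -/
theorem pos_of_logConvex (h0 : 0 < s 0) (h1 : 0 < s 1) (hlc : ∀ n, s (n + 1) ^ 2 ≤ s n * s (n + 2)) :
    ∀ n, 0 < s n := by
  have key : ∀ n, 0 < s n ∧ 0 < s (n + 1) := by
    intro n
    induction n with
    | zero => exact ⟨h0, h1⟩
    | succ n ih =>
      refine ⟨ih.2, ?_⟩
      have h := hlc n
      have hsq : 0 < s (n + 1) ^ 2 := pow_pos ih.2 2
      have hprod : 0 < s n * s (n + 2) := lt_of_lt_of_le hsq h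
      exact pos_of_mul_pos_right hprod ih.1.le
  exact fun n => (key n).1

/-- ★ **Schwarz quotients are monotone**: for a positive log-convex sequence the quotients `s(n+1)/s(n)` are nondecreasing.
[cite: RadeWestergren1999, §12.1 (Schwarz' quotients)] -/
theorem quot_mono (hpos : ∀ n, 0 < s n) (hlc : ∀ n, s (n + 1) ^ 2 ≤ s n * s (n + 2)) :
    Monotone fun n => s (n + 1) / s n := by
  refine monotone_nat_of_le_succ fun n => ?_
  show s (n + 1) / s n ≤ s (n + 1 + 1) / s (n + 1)
  rw [div_le_div_iff₀ (hpos n) (hpos (n + 1))]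
  have h := hlc n
  rw [sq] at h
  simpa [add_assoc, mul_comm] using h

/-- Geometric growth at least at the current quotient: `s(N) · (s(N+1)/s(N))^k ≤ s(N+k)`. [cite: RadeWestergren1999, §12.1] -/
theorem mul_pow_quot_le (hpos : ∀ n, 0 < s n) (hlc : ∀ n, s (n + 1) ^ 2 ≤ s n * s (n + 2)) (N k : ℕ) :
    s N * (s (N + 1) / s N) ^ k ≤ s (N + k) := by
  induction k with
  | zero => simp
  | succ k ih =>
    have hq : s (N + 1) / s N ≤ s (N + k + 1) / s (N + k) := quot_mono hpos hlc (Nat.le_add_right N k)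
    have hqpos : 0 ≤ s (N + 1) / s N := div_nonneg (hpos _).le (hpos _).le
    calc s N * (s (N + 1) / s N) ^ (k + 1) = s N * (s (N + 1) / s N) ^ k * (s (N + 1) / s N) := by ring
      _ ≤ s (N + k) * (s (N + k + 1) / s (N + k)) := mul_le_mul ih hq hqpos (hpos _).le
      _ = s (N + (k + 1)) := by rw [mul_div_cancel₀ _ (hpos _).ne', add_assoc]

/-- If every quotient is `≤ ρ` then `sₙ ≤ s₀ ρⁿ`. [cite: RadeWestergren1999, §12.1] -/
theorem le_mul_pow_of_quot_le (hpos : ∀ n, 0 < s n) {ρ : ℝ} (hρ : ∀ n, s (n + 1) / s n ≤ ρ) (n : ℕ) :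
    s n ≤ s 0 * ρ ^ n := by
  induction n with
  | zero => simp
  | succ n ih =>
    have hρ0 : 0 ≤ ρ := le_trans (div_nonneg (hpos 1).le (hpos 0).le) (hρ 0)
    have h1 : s (n + 1) ≤ s n * ρ := by
      have := hρ n
      rwa [div_le_iff₀ (hpos n), mul_comm] at this
    calc s (n + 1) ≤ s n * ρ := h1
      _ ≤ s 0 * ρ ^ n * ρ := mul_le_mul_of_nonneg_right ih hρ0
      _ = s 0 * ρ ^ (n + 1) := by ring

/-- Bounded quotients: the range of `n ↦ s(n+1)/s(n)` is bounded above by `M`. [folklore] -/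
private theorem bddAbove_quot {M : ℝ} (hbdd : ∀ n, s (n + 1) / s n ≤ M) :
    BddAbove (Set.range fun n => s (n + 1) / s n) := ⟨M, by rintro _ ⟨n, rfl⟩; exact hbdd n⟩

/-- Each quotient is below the supremum `ρ = ⨆ₙ s(n+1)/s(n)`. [cite: RadeWestergren1999, §12.1] -/
theorem quot_le_ciSup {M : ℝ} (hbdd : ∀ n, s (n + 1) / s n ≤ M) (n : ℕ) :
    s (n + 1) / s n ≤ ⨆ k, s (k + 1) / s k :=
  le_ciSup (bddAbove_quot hbdd) n

/-- The supremum of the quotients is below any uniform bound. [cite: RadeWestergren1999, §12.1] -/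
theorem ciSup_quot_le {M : ℝ} (hbdd : ∀ n, s (n + 1) / s n ≤ M) : (⨆ k, s (k + 1) / s k) ≤ M :=
  ciSup_le hbdd

/-- ★ **Convergence of the Schwarz quotients**: for a positive log-convex sequence with bounded quotients, `s(n+1)/s(n) → ρ = ⨆ₙ s(n+1)/s(n)`
(monotone and bounded). [cite: RadeWestergren1999, §12.1 (Schwarz' quotients `μ_k → λ₁` monotonically)] -/
theorem tendsto_quot (hpos : ∀ n, 0 < s n) (hlc : ∀ n, s (n + 1) ^ 2 ≤ s n * s (n + 2)) {M : ℝ}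
    (hbdd : ∀ n, s (n + 1) / s n ≤ M) :
    Tendsto (fun n => s (n + 1) / s n) atTop (𝓝 (⨆ k, s (k + 1) / s k)) :=
  tendsto_atTop_ciSup (quot_mono hpos hlc) (bddAbove_quot hbdd)

/-- The even-indexed quotients `s(2m+1)/s(2m)` (= the Rayleigh quotients of the iterates `Kᵐv` when `sₙ = B(v, Kⁿv)`) converge to the same
limit. [cite: RadeWestergren1999, §12.1] -/
theorem tendsto_quot_two_mul (hpos : ∀ n, 0 < s n) (hlc : ∀ n, s (n + 1) ^ 2 ≤ s n * s (n + 2)) {M : ℝ}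
    (hbdd : ∀ n, s (n + 1) / s n ≤ M) :
    Tendsto (fun m => s (2 * m + 1) / s (2 * m)) atTop (𝓝 (⨆ k, s (k + 1) / s k)) := by
  have h2 : Tendsto (fun m : ℕ => 2 * m) atTop atTop :=
    tendsto_atTop_atTop.mpr fun b => ⟨b, fun m hm => by omega⟩
  exact (tendsto_quot hpos hlc hbdd).comp h2

/-- The even-indexed quotients are nondecreasing in `m`. [cite: RadeWestergren1999, §12.1] -/
theorem quot_two_mul_mono (hpos : ∀ n, 0 < s n) (hlc : ∀ n, s (n + 1) ^ 2 ≤ s n * s (n + 2)) :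
    Monotone fun m => s (2 * m + 1) / s (2 * m) :=
  fun _ _ hab => quot_mono hpos hlc (by omega)

/-- The sup of the quotients of a positive log-convex sequence is positive. [folklore] -/
private theorem ciSup_quot_pos (hpos : ∀ n, 0 < s n) {M : ℝ} (hbdd : ∀ n, s (n + 1) / s n ≤ M) :
    0 < ⨆ k, s (k + 1) / s k :=
  lt_of_lt_of_le (div_pos (hpos 1) (hpos 0)) (quot_le_ciSup hbdd 0)

/-- ★ **Comparison principle.**  Let `s` be positive with quotients bounded by `M` (`ρ := ⨆ₙ s(n+1)/s(n)`), and let `t` be log-convex with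
`t₀ > 0`.  If `t` is DOMINATED by `s` in every moment, `tₙ ≤ c·sₙ` for all `n`, then its first quotient is below the growth rate of `s`:
`t₁/t₀ ≤ ρ`.  (Otherwise `tₙ ≥ t₀(t₁/t₀)ⁿ` outgrows `c·sₙ ≤ c·s₀ρⁿ`.)  This is what turns «the iterates of ONE vector `v` have Rayleigh
quotients `↑ ρ(v)`» into «`ρ(v)` dominates the Rayleigh quotient of every vector dominated by `v`».
[cite: RadeWestergren1999, §12.1] [cite: GolubVanLoan2013, §8.2] -/
theorem quot_zero_le_ciSup_of_le_mul (hpos : ∀ n, 0 < s n) {M : ℝ}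
    (hbdd : ∀ n, s (n + 1) / s n ≤ M) {t : ℕ → ℝ} (ht0 : 0 < t 0)
    (htlc : ∀ n, t (n + 1) ^ 2 ≤ t n * t (n + 2)) {c : ℝ} (hdom : ∀ n, t n ≤ c * s n) :
    t 1 / t 0 ≤ ⨆ k, s (k + 1) / s k := by
  set ρ : ℝ := ⨆ k, s (k + 1) / s k with hρdef
  have hρpos : 0 < ρ := ciSup_quot_pos hpos hbdd
  by_contra hlt
  rw [not_le] at hlt
  -- then `t₁ > 0`, so `t` is positive throughout
  have ht1 : 0 < t 1 := by
    have : 0 < t 1 / t 0 := hρpos.trans hlt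
    exact (div_pos_iff_of_pos_right ht0).mp this
  have htpos : ∀ n, 0 < t n := pos_of_logConvex ht0 ht1 htlc
  set q : ℝ := t 1 / t 0 with hqdef
  -- lower growth of `t`, upper growth of `s`
  have hlow : ∀ n, t 0 * q ^ n ≤ t n := fun n => by
    simpa using mul_pow_quot_le htpos htlc 0 n
  have hup : ∀ n, s n ≤ s 0 * ρ ^ n := le_mul_pow_of_quot_le hpos (quot_le_ciSup hbdd)
  have hc : 0 < c := by
    have h := hdom 0
    have : 0 < c * s 0 := ht0.trans_le h
    exact pos_of_mul_pos_left this (hpos 0).le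
  -- `(q/ρ)^n ≤ c s₀ / t₀` for all `n`, but `q/ρ > 1`
  have hratio : 1 < q / ρ := (one_lt_div hρpos).mpr hlt
  have hbig := tendsto_pow_atTop_atTop_of_one_lt hratio
  have hbound : ∀ n, (q / ρ) ^ n ≤ c * s 0 / t 0 := by
    intro n
    have h1 : t 0 * q ^ n ≤ c * (s 0 * ρ ^ n) := (hlow n).trans ((hdom n).trans (by gcongr; exact hup n))
    rw [div_pow, div_le_div_iff₀ (pow_pos hρpos n) ht0]
    nlinarith [h1]
  obtain ⟨N, hN⟩ := (tendsto_atTop_atTop.mp hbig) (c * s 0 / t 0 + 1)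
  have := hN N le_rfl
  linarith [hbound N]

/-- ★ **Exponential clustering bounds the Rayleigh quotient** (the spectral reading of a uniform decay rate): if `t` is log-convex with
`t₀ > 0` (e.g. `tₙ = ⟨ψ, Kⁿψ⟩` for a positive symmetric `K`) and `tₙ ≤ A·ρⁿ` for all `n` with `ρ > 0`, then `t₁/t₀ ≤ ρ`: a vector all of whose
time correlations decay at rate `ρ` has Rayleigh quotient at most `ρ`, WHATEVER the prefactor `A` (comparison principle with `sₙ = ρⁿ`).
[cite: RadeWestergren1999, §12.1] [cite: GolubVanLoan2013, §8.2] -/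
theorem quot_zero_le_of_le_mul_pow {t : ℕ → ℝ} (ht0 : 0 < t 0) (htlc : ∀ n, t (n + 1) ^ 2 ≤ t n * t (n + 2))
    {A ρ : ℝ} (hρ : 0 < ρ) (hdom : ∀ n, t n ≤ A * ρ ^ n) : t 1 / t 0 ≤ ρ := by
  have hpos : ∀ n, 0 < ρ ^ n := fun n => pow_pos hρ n
  have hq : ∀ n, ρ ^ (n + 1) / ρ ^ n = ρ := fun n => by
    rw [pow_succ, mul_comm, mul_div_assoc, div_self (hpos n).ne', mul_one]
  have hbdd : ∀ n, ρ ^ (n + 1) / ρ ^ n ≤ ρ := fun n => (hq n).le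
  have h := quot_zero_le_ciSup_of_le_mul (s := fun n => ρ ^ n) hpos hbdd ht0 htlc hdom
  have hsup : (⨆ k, ρ ^ (k + 1) / ρ ^ k) = ρ := by
    simp_rw [hq]; exact ciSup_const
  simpa [hsup] using h

/-- The same with the decay hypothesis only EVENTUALLY normalised: `tₙ ≤ A·ρⁿ` for all `n` and `t₀ > 0` give, for every `m` with `t` positive,
the quotient bound at the origin; stated here as the contrapositive-free monotone consequence `tₙ₊₁/tₙ ≤ ρ` for ALL `n` when `t` is positive
(quotients are nondecreasing and their supremum is `≤ ρ`). [cite: RadeWestergren1999, §12.1] -/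
theorem quot_le_of_le_mul_pow {t : ℕ → ℝ} (htpos : ∀ n, 0 < t n) (htlc : ∀ n, t (n + 1) ^ 2 ≤ t n * t (n + 2))
    {A ρ : ℝ} (hρ : 0 < ρ) (hdom : ∀ n, t n ≤ A * ρ ^ n) (n : ℕ) : t (n + 1) / t n ≤ ρ := by
  -- apply the previous lemma to the shifted sequence `k ↦ t (n + k)`, dominated by `(A ρⁿ)·ρᵏ`
  have h := quot_zero_le_of_le_mul_pow (t := fun k => t (n + k)) (by simpa using htpos n)
    (fun k => by simpa [add_assoc] using htlc (n + k)) hρ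
    (A := A * ρ ^ n) (fun k => by simpa [pow_add, mul_assoc] using hdom (n + k))
  simpa using h

end Seq

/-! ## §2 Schwarz constants of a positive symmetric operator with respect to a positive symmetric bilinear form -/

section Bilin

variable {V : Type*} [AddCommGroup V] [Module ℝ V]

/-- **Cauchy–Schwarz for a symmetric positive-semidefinite bilinear form** (no definiteness, no completeness): `B(x,y)² ≤ B(x,x)·B(y,y)`.
(Nonnegativity of the quadratic `t ↦ B(x+ty, x+ty)` and the discriminant.) [folklore] -/
private theorem bilin_sq_le (B : V →ₗ[ℝ] V →ₗ[ℝ] ℝ) (hsymm : ∀ x y, B x y = B y x) (hpos : ∀ x, 0 ≤ B x x) (x y : V) :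
    (B x y) ^ 2 ≤ B x x * B y y := by
  have hquad : ∀ t : ℝ, 0 ≤ B y y * (t * t) + 2 * B x y * t + B x x := by
    intro t
    have h := hpos (x + t • y)
    have e : B (x + t • y) (x + t • y) = B y y * (t * t) + 2 * B x y * t + B x x := by
      simp only [map_add, map_smul, LinearMap.add_apply, LinearMap.smul_apply, smul_eq_mul, hsymm y x]
      ring
    rwa [e] at h
  have hd := discrim_le_zero hquad
  rw [discrim] at hd
  nlinarith [hd]

variable (B : V →ₗ[ℝ] V →ₗ[ℝ] ℝ) (K : V →ₗ[ℝ] V) (v : V)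

/-- `B`-symmetry transports one power of `K` across the form along the orbit: `B(Kⁱv, K^{j+1}v) = B(K^{i+1}v, Kʲv)`.
[cite: RadeWestergren1999, §12.1 (Schwarz' constants «independent of m»)] -/
theorem bilin_iterate_succ (hK : ∀ x y, B (K x) y = B x (K y)) (i j : ℕ) :
    B (K^[i] v) (K^[j + 1] v) = B (K^[i + 1] v) (K^[j] v) := by
  rw [Function.iterate_succ_apply', Function.iterate_succ_apply', hK]

/-- ★ **The Schwarz constants do not depend on the split** («independent of `m`»): `B(Kⁱv, Kʲv) = B(v, K^{i+j}v)`.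
[cite: RadeWestergren1999, §12.1 (Schwarz' constants)] -/
theorem bilin_iterate_iterate (hK : ∀ x y, B (K x) y = B x (K y)) (i j : ℕ) :
    B (K^[i] v) (K^[j] v) = B v (K^[i + j] v) := by
  induction i generalizing j with
  | zero => simp
  | succ i ih =>
    rw [← bilin_iterate_succ B K v hK i j, ih (j + 1)]
    congr 2
    omega

/-- The Schwarz constants of a `B`-positive `K` w.r.t. a positive-semidefinite `B` are nonnegative: `0 ≤ B(v, Kⁿv)`.
[cite: RadeWestergren1999, §12.1] -/
theorem schwarz_nonneg (hsymm : ∀ x y, B x y = B y x) (hpos : ∀ x, 0 ≤ B x x)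
    (hK : ∀ x y, B (K x) y = B x (K y)) (hKpos : ∀ x, 0 ≤ B (K x) x) (n : ℕ) :
    0 ≤ B v (K^[n] v) := by
  obtain ⟨j, rfl | rfl⟩ := Nat.even_or_odd' n
  · rw [two_mul, ← bilin_iterate_iterate B K v hK j j]
    exact hpos _
  · rw [show 2 * j + 1 = j + (j + 1) by omega, ← bilin_iterate_iterate B K v hK j (j + 1),
      Function.iterate_succ_apply', hsymm]
    exact hKpos _

/-- ★ **Log-convexity of the Schwarz constants** (the «dyadic Cauchy–Schwarz»): `a(n+1)² ≤ a(n)·a(n+2)` for `aₙ = B(v, Kⁿv)` —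
Cauchy–Schwarz for `B` between `Kʲv` and `K^{j+1}v` at `n = 2j`, and for the positive symmetric form `B(K·, ·)` at `n = 2j+1`.
[cite: RadeWestergren1999, §12.1 (Schwarz' quotients are monotone)] -/
theorem schwarz_logConvex (hsymm : ∀ x y, B x y = B y x) (hpos : ∀ x, 0 ≤ B x x)
    (hK : ∀ x y, B (K x) y = B x (K y)) (hKpos : ∀ x, 0 ≤ B (K x) x) (n : ℕ) :
    (B v (K^[n + 1] v)) ^ 2 ≤ B v (K^[n] v) * B v (K^[n + 2] v) := by
  obtain ⟨j, rfl | rfl⟩ := Nat.even_or_odd' n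
  · -- `n = 2j`: CS for `B` with `x = Kʲv`, `y = K^{j+1}v`
    have e1 : B v (K^[2 * j + 1] v) = B (K^[j] v) (K^[j + 1] v) := by
      rw [bilin_iterate_iterate B K v hK]; congr 2; omega
    have e0 : B v (K^[2 * j] v) = B (K^[j] v) (K^[j] v) := by
      rw [bilin_iterate_iterate B K v hK]; congr 2; omega
    have e2 : B v (K^[2 * j + 2] v) = B (K^[j + 1] v) (K^[j + 1] v) := by
      rw [bilin_iterate_iterate B K v hK]; congr 2; omega
    rw [e1, e0, e2]
    exact bilin_sq_le B hsymm hpos _ _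
  · -- `n = 2j+1`: CS for the form `B_K(x, y) = B(Kx, y)` with `x = Kʲv`, `y = K^{j+1}v`
    set BK : V →ₗ[ℝ] V →ₗ[ℝ] ℝ := B.comp K with hBK
    have hBK_apply : ∀ x y, BK x y = B (K x) y := fun x y => by rw [hBK, LinearMap.comp_apply]
    have hBKsymm : ∀ x y, BK x y = BK y x := fun x y => by rw [hBK_apply, hBK_apply, hK, hsymm]
    have hBKpos : ∀ x, 0 ≤ BK x x := fun x => by rw [hBK_apply]; exact hKpos x
    have e1 : B v (K^[2 * j + 1 + 1] v) = BK (K^[j] v) (K^[j + 1] v) := by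
      rw [hBK_apply, ← Function.iterate_succ_apply' K j, bilin_iterate_iterate B K v hK]; congr 2; omega
    have e0 : B v (K^[2 * j + 1] v) = BK (K^[j] v) (K^[j] v) := by
      rw [hBK_apply, ← Function.iterate_succ_apply' K j, bilin_iterate_iterate B K v hK]; congr 2; omega
    have e2 : B v (K^[2 * j + 1 + 2] v) = BK (K^[j + 1] v) (K^[j + 1] v) := by
      rw [hBK_apply, ← Function.iterate_succ_apply' K (j + 1), bilin_iterate_iterate B K v hK]; congr 2; omega
    rw [e1, e0, e2]
    exact bilin_sq_le BK hBKsymm hBKpos _ _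

/-- The Rayleigh quotient of the `m`-th iterate is the `2m`-th Schwarz quotient:
`B(Kᵐv, K·Kᵐv)/B(Kᵐv, Kᵐv) = a(2m+1)/a(2m)`. [cite: RadeWestergren1999, §12.1] -/
theorem rayleigh_iterate_eq_quot (hK : ∀ x y, B (K x) y = B x (K y)) (m : ℕ) :
    B (K^[m] v) (K (K^[m] v)) / B (K^[m] v) (K^[m] v) = B v (K^[2 * m + 1] v) / B v (K^[2 * m] v) := by
  rw [← Function.iterate_succ_apply' K m, bilin_iterate_iterate B K v hK, bilin_iterate_iterate B K v hK]
  congr 3 <;> omega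

/-- If `a₀ = B(v,v) > 0` and `a₁ = B(v, Kv) > 0` then every Schwarz constant is positive (log-convexity). [cite: RadeWestergren1999, §12.1] -/
theorem schwarz_pos (hsymm : ∀ x y, B x y = B y x) (hpos : ∀ x, 0 ≤ B x x)
    (hK : ∀ x y, B (K x) y = B x (K y)) (hKpos : ∀ x, 0 ≤ B (K x) x)
    (h0 : 0 < B v v) (h1 : 0 < B v (K v)) : ∀ n, 0 < B v (K^[n] v) := by
  have := pos_of_logConvex (s := fun n => B v (K^[n] v)) (by simpa using h0) (by simpa using h1)
    (schwarz_logConvex B K v hsymm hpos hK hKpos)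
  exact this

/-- A Rayleigh bound ALONG THE ORBIT bounds every Schwarz quotient (odd ones through monotonicity):
`B(Kᵐv, K^{m+1}v) ≤ M·B(Kᵐv, Kᵐv)` for all `m` ⟹ `a(n+1)/a(n) ≤ M` for all `n`. [cite: RadeWestergren1999, §12.1] -/
theorem quot_le_of_rayleigh_le (hsymm : ∀ x y, B x y = B y x) (hpos : ∀ x, 0 ≤ B x x)
    (hK : ∀ x y, B (K x) y = B x (K y)) (hKpos : ∀ x, 0 ≤ B (K x) x)
    (hapos : ∀ n, 0 < B v (K^[n] v)) {M : ℝ}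
    (hM : ∀ m, B (K^[m] v) (K (K^[m] v)) ≤ M * B (K^[m] v) (K^[m] v)) (n : ℕ) :
    B v (K^[n + 1] v) / B v (K^[n] v) ≤ M := by
  have hlc := schwarz_logConvex B K v hsymm hpos hK hKpos
  have heven : ∀ m, B v (K^[2 * m + 1] v) / B v (K^[2 * m] v) ≤ M := by
    intro m
    have hp : 0 < B (K^[m] v) (K^[m] v) := by
      rw [bilin_iterate_iterate B K v hK m m, show m + m = 2 * m by omega]; exact hapos _
    rw [← rayleigh_iterate_eq_quot B K v hK m, div_le_iff₀ hp]
    exact hM m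
  obtain ⟨m, rfl | rfl⟩ := Nat.even_or_odd' n
  · exact heven m
  · calc B v (K^[2 * m + 1 + 1] v) / B v (K^[2 * m + 1] v)
          ≤ B v (K^[2 * (m + 1) + 1] v) / B v (K^[2 * (m + 1)] v) :=
            quot_mono hapos hlc (show 2 * m + 1 ≤ 2 * (m + 1) by omega)
      _ ≤ M := heven (m + 1)

/-- ★ **The Rayleigh quotients of the iterates are nondecreasing**: `m ↦ R(Kᵐv) = B(Kᵐv, K·Kᵐv)/B(Kᵐv, Kᵐv)` is monotone (for `B` symmetric
positive semidefinite, `K` `B`-symmetric and `B`-positive, all Schwarz constants of `v` positive). [cite: RadeWestergren1999, §12.1 (Schwarz' quotients)] -/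
theorem rayleigh_iterate_mono (hsymm : ∀ x y, B x y = B y x) (hpos : ∀ x, 0 ≤ B x x)
    (hK : ∀ x y, B (K x) y = B x (K y)) (hKpos : ∀ x, 0 ≤ B (K x) x)
    (hapos : ∀ n, 0 < B v (K^[n] v)) :
    Monotone fun m => B (K^[m] v) (K (K^[m] v)) / B (K^[m] v) (K^[m] v) := by
  have hlc := schwarz_logConvex B K v hsymm hpos hK hKpos
  intro a b hab
  simp only [rayleigh_iterate_eq_quot B K v hK]
  exact quot_two_mul_mono hapos hlc hab

/-- ★ **Convergence of the power iteration (Kellogg / Schwarz quotients), variational form**: under a Rayleigh bound `M` along the orbit,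
`R(Kᵐv) → ρ(v) := ⨆ₙ a(n+1)/a(n)` as `m → ∞` — no compactness, no spectral theorem, no Perron–Frobenius.
[cite: RadeWestergren1999, §12.1 (Schwarz' quotients `→ λ₁` monotonically)] [cite: GolubVanLoan2013, §8.2] -/
theorem tendsto_rayleigh_iterate (hsymm : ∀ x y, B x y = B y x) (hpos : ∀ x, 0 ≤ B x x)
    (hK : ∀ x y, B (K x) y = B x (K y)) (hKpos : ∀ x, 0 ≤ B (K x) x)
    (hapos : ∀ n, 0 < B v (K^[n] v)) {M : ℝ}
    (hM : ∀ m, B (K^[m] v) (K (K^[m] v)) ≤ M * B (K^[m] v) (K^[m] v)) :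
    Tendsto (fun m => B (K^[m] v) (K (K^[m] v)) / B (K^[m] v) (K^[m] v)) atTop
      (𝓝 (⨆ n, B v (K^[n + 1] v) / B v (K^[n] v))) := by
  have hlc := schwarz_logConvex B K v hsymm hpos hK hKpos
  have hbdd := quot_le_of_rayleigh_le B K v hsymm hpos hK hKpos hapos hM
  have h := tendsto_quot_two_mul hapos hlc hbdd
  exact Tendsto.congr (fun m => (rayleigh_iterate_eq_quot B K v hK m).symm) h

/-- The limit dominates the starting Rayleigh quotient: `R(v) ≤ ρ(v)`. [cite: RadeWestergren1999, §12.1] -/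
theorem rayleigh_le_ciSup (hsymm : ∀ x y, B x y = B y x) (hpos : ∀ x, 0 ≤ B x x)
    (hK : ∀ x y, B (K x) y = B x (K y)) (hKpos : ∀ x, 0 ≤ B (K x) x)
    (hapos : ∀ n, 0 < B v (K^[n] v)) {M : ℝ}
    (hM : ∀ m, B (K^[m] v) (K (K^[m] v)) ≤ M * B (K^[m] v) (K^[m] v)) :
    B v (K v) / B v v ≤ ⨆ n, B v (K^[n + 1] v) / B v (K^[n] v) := by
  have hbdd := quot_le_of_rayleigh_le B K v hsymm hpos hK hKpos hapos hM
  simpa using quot_le_ciSup (s := fun n => B v (K^[n] v)) hbdd 0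

/-- Every iterate's Rayleigh quotient is below the limit: `R(Kᵐv) ≤ ρ(v)`. [cite: RadeWestergren1999, §12.1] -/
theorem rayleigh_iterate_le_ciSup (hsymm : ∀ x y, B x y = B y x) (hpos : ∀ x, 0 ≤ B x x)
    (hK : ∀ x y, B (K x) y = B x (K y)) (hKpos : ∀ x, 0 ≤ B (K x) x)
    (hapos : ∀ n, 0 < B v (K^[n] v)) {M : ℝ}
    (hM : ∀ m, B (K^[m] v) (K (K^[m] v)) ≤ M * B (K^[m] v) (K^[m] v)) (m : ℕ) :
    B (K^[m] v) (K (K^[m] v)) / B (K^[m] v) (K^[m] v) ≤ ⨆ n, B v (K^[n + 1] v) / B v (K^[n] v) := by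
  have hbdd := quot_le_of_rayleigh_le B K v hsymm hpos hK hKpos hapos hM
  rw [rayleigh_iterate_eq_quot B K v hK m]
  exact quot_le_ciSup (s := fun n => B v (K^[n] v)) hbdd (2 * m)

/-- The limit is below the Rayleigh bound: `ρ(v) ≤ M`. [cite: RadeWestergren1999, §12.1] -/
theorem ciSup_le_of_rayleigh_le (hsymm : ∀ x y, B x y = B y x) (hpos : ∀ x, 0 ≤ B x x)
    (hK : ∀ x y, B (K x) y = B x (K y)) (hKpos : ∀ x, 0 ≤ B (K x) x)
    (hapos : ∀ n, 0 < B v (K^[n] v)) {M : ℝ}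
    (hM : ∀ m, B (K^[m] v) (K (K^[m] v)) ≤ M * B (K^[m] v) (K^[m] v)) :
    (⨆ n, B v (K^[n + 1] v) / B v (K^[n] v)) ≤ M :=
  ciSup_quot_le (s := fun n => B v (K^[n] v)) (quot_le_of_rayleigh_le B K v hsymm hpos hK hKpos hapos hM)

/-- ★ **Comparison principle for Rayleigh quotients**: if `w` is dominated by `v` in every Schwarz constant, `B(w, Kⁿw) ≤ c·B(v, Kⁿv)`, and
`B(w, w) > 0`, then `R(w) ≤ ρ(v) = lim R(Kᵐv)`.  (For a transfer operator with pointwise-positive kernel and `v = 1` every bounded `ψ` is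
dominated with `c = sup ψ²`, whence `lim R(Kᵐ1) = sup_ψ R(ψ)`: the iterated free-boundary slab is a vacuum proxy.)
[cite: RadeWestergren1999, §12.1] [cite: GolubVanLoan2013, §8.2] -/
theorem rayleigh_le_ciSup_of_dominated (hsymm : ∀ x y, B x y = B y x) (hpos : ∀ x, 0 ≤ B x x)
    (hK : ∀ x y, B (K x) y = B x (K y)) (hKpos : ∀ x, 0 ≤ B (K x) x)
    (hapos : ∀ n, 0 < B v (K^[n] v)) {M : ℝ}
    (hM : ∀ m, B (K^[m] v) (K (K^[m] v)) ≤ M * B (K^[m] v) (K^[m] v))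
    {w : V} (hw0 : 0 < B w w) {c : ℝ} (hdom : ∀ n, B w (K^[n] w) ≤ c * B v (K^[n] v)) :
    B w (K w) / B w w ≤ ⨆ n, B v (K^[n + 1] v) / B v (K^[n] v) := by
  have hbdd := quot_le_of_rayleigh_le B K v hsymm hpos hK hKpos hapos hM
  have htlc := schwarz_logConvex B K w hsymm hpos hK hKpos
  have h := quot_zero_le_ciSup_of_le_mul hapos hbdd (t := fun n => B w (K^[n] w))
    (by simpa using hw0) htlc hdom
  simpa using h

end Bilin

end Literature.Analysis.OperatorTheory.SchwarzQuotients
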